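import Summits.AtomisticToContinuum.HydrodynamicLimit.Theorems.InformationPercolationEnginePercolationClosesChaosForecastTransferArch
import Summits.AtomisticToContinuum.HydrodynamicLimit.Theorems.InformationPercolationEnginePercolationClosesChaosForecastFiltration
import Summits.AtomisticToContinuum.HydrodynamicLimit.Theorems.InformationPercolationEnginePercolationClosesChaosCesaroTransfer
import Summits.AtomisticToContinuum.HydrodynamicLimit.Theorems.InformationPercolationEnginePercolationClosesChaosDockingTiling
import HarnessLib

/-!
# Forecast transfer S6 of the line `equilibrium-forecast-chain-rule` (crux `InformationPercolationEngine.PercolationClosesChaos`,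
stmt-AtomisticToContinuum-15178) — piece H1: `ForecastSwap` HOLDS (the engine applied in the sequential filtration)

Support file (`--supports stmt-AtomisticToContinuum-15178`) of the registered stub `stub_forecastTransfer` (worker S6 of lead c3):
the first hypothesis `ForecastSwap` of the architecture `kineticCellChaosLG_of` (piece A) is DISCHARGED — the predictable-projection
bound `PredictableProjection` (S1, `predictableProjection_holds`) applied on `Ω = Phase N` to `μ = LG`, `ν = G_N = eqLaw`, the
start-cell observation sequence `Y = Yseq b c σ N Φ` (pieces F/F′: `pastSigma_Yseq_le`, `pastSigma_Yseq_eq_seqHist`,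
`measurable_pastSigma_Yseq_succ_of_imp`) and the stage increments `X_n = X (n / M) (nthCell h (n % M))` of a revealed,
box-supported, `[0, T]`-valued unit family `X` (piece E: `sum_range_mul_card_cellBox`, `stage_div`, `nthCell_stage_mod`), with the
entropy budget `KL(LG ‖ G_N) ≤ A(N+1)` (`exists_lgTransferConst`). By the tower property `∫ X dLG = ∫ E_LG[X | 𝓕] dLG`
(`integral_condExp`, `σ(seqHist k q) ≤` Borel) the two unit means differ by at most
`K⁻¹h³ · T √(2 K M · A(N+1)) = T √(2 A · h³M · h³(N+1) / K) ≤ T √(54 A · cellCount / K_N)` (`h³ M ≤ 27`, `h³ (N+1) = c³/(π³σ⁶)`,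
`cellCount_eq`), which is `≤ ε` as soon as `K_N > 54 T² A cellCount / ε²` — true for large `N` at fixed `c` because `ℓ_N → 0`
(`exists_mesh_le`). Registered headline: `forecastSwap_holds : ForecastSwap`.
-/

noncomputable section

open MeasureTheory Set Filter Topology
open scoped ENNReal BigOperators Classical
open Literature.Analysis.FluidPDE Literature.MathematicalPhysics.KineticTheory
open Literature.MathematicalPhysics.KineticTheory.VelocityBlindPlacement

namespace Summit.AtomisticToContinuum.HydrodynamicLimit.Theorems.EquilibriumForecastLine

/-- The kinetic scale shrinks below any positive bound: for `σ > 0`, every `c` and `a > 0`, `c ℓ_N ≤ a` for all large `N`.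
[folklore] -/
theorem exists_mesh_le {σ : ℝ} (hσ : 0 < σ) (c : ℝ) {a : ℝ} (ha : 0 < a) :
    ∃ N₀ : ℕ, ∀ N : ℕ, N₀ ≤ N → c * meanFreePath σ N ≤ a := by
  have ht : Tendsto (fun N : ℕ => c * meanFreePath σ N) atTop (nhds (c * 0)) :=
    (tendsto_meanFreePath hσ).const_mul c
  rw [mul_zero] at ht
  obtain ⟨N₀, hN₀⟩ := eventually_atTop.1 (ht.eventually (Iic_mem_nhds ha))
  exact ⟨N₀, fun N hN => hN₀ N hN⟩

/-- The number of complete steps exceeds any level for large `N` (fixed `c > 0`, `τ > 0`). [folklore] -/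
theorem exists_lt_numSteps {σ : ℝ} (hσ : 0 < σ) {c : ℝ} (hc : 0 < c) {τ : ℝ} (hτ : 0 < τ) {L : ℝ} (hL : 0 ≤ L) :
    ∃ N₀ : ℕ, ∀ N : ℕ, N₀ ≤ N → L < (numSteps c σ N τ : ℝ) := by
  obtain ⟨N₀, hN₀⟩ := exists_mesh_le hσ c (a := τ / (L + 1)) (by positivity)
  refine ⟨N₀, fun N hN => ?_⟩
  have hΔ : 0 < stepLen c σ N := stepLen_pos hc hσ N
  have hle : L + 1 ≤ τ / stepLen c σ N := by
    rw [le_div_iff₀ hΔ]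
    calc (L + 1) * stepLen c σ N ≤ (L + 1) * (τ / (L + 1)) := mul_le_mul_of_nonneg_left (hN₀ N hN) (by positivity)
      _ = τ := by field_simp
  have hfl := Nat.sub_one_lt_floor (τ / stepLen c σ N)
  unfold numSteps
  linarith

/-- A revealed unit function (constant on the atoms of `seqHistLE k q`) is Borel measurable (piece F′). [folklore] -/
theorem measurable_of_revealed {σ : ℝ} {N : ℕ} (Φ : Flow σ N) (b c : ℝ) (k : ℕ) (q : Cell) {X : Phase N → ℝ}
    (hX : ∀ z z', seqHistLE b c σ N Φ k q z = seqHistLE b c σ N Φ k q z' → X z = X z') : Measurable X :=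
  (measurable_comap_top_of_imp hX).mono (comap_seqHistLE_le Φ b c k q) le_rfl

/-- The arithmetic of the remainder: with `w = K⁻¹ h³`, `h³ M ≤ 27`, `h³ (N+1) = cc` and `54 T² A cc / ε² < K`,
`w T √(2 K M A (N+1)) ≤ ε`. [folklore] -/
theorem remainder_le {h T A cc ε : ℝ} {K M : ℕ} (Nr : ℝ) (hh : 0 < h) (hT : 0 ≤ T) (hA : 0 ≤ A) (hε : 0 < ε)
    (hK : 54 * T ^ 2 * A * cc / ε ^ 2 < K) (h27 : h ^ 3 * (M : ℝ) ≤ 27) (hcc : h ^ 3 * Nr = cc) (hNr : 0 ≤ Nr) :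
    ((K : ℝ))⁻¹ * h ^ 3 * (T * Real.sqrt (2 * ((K * M : ℕ) : ℝ) * (A * Nr))) ≤ ε := by
  have hcc0 : 0 ≤ cc := by rw [← hcc]; positivity
  have hKpos : (0 : ℝ) < K := lt_of_le_of_lt (by positivity) hK
  have hw : 0 ≤ ((K : ℝ))⁻¹ * h ^ 3 * T := by positivity
  have hsq : (((K : ℝ))⁻¹ * h ^ 3 * T) ^ 2 * (2 * ((K * M : ℕ) : ℝ) * (A * Nr)) ≤ ε ^ 2 := by
    have h1 : (((K : ℝ))⁻¹ * h ^ 3 * T) ^ 2 * (2 * ((K * M : ℕ) : ℝ) * (A * Nr)) =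
        2 * T ^ 2 * A * (h ^ 3 * (M : ℝ)) * (h ^ 3 * Nr) / K := by
      push_cast
      field_simp
    rw [h1, hcc, div_le_iff₀ hKpos]
    rw [div_lt_iff₀ (by positivity)] at hK
    have h2 : 2 * T ^ 2 * A * (h ^ 3 * (M : ℝ)) * cc ≤ 2 * T ^ 2 * A * 27 * cc := by
      have : 0 ≤ 2 * T ^ 2 * A := by positivity
      nlinarith [mul_nonneg this hcc0]
    nlinarith
  calc ((K : ℝ))⁻¹ * h ^ 3 * (T * Real.sqrt (2 * ((K * M : ℕ) : ℝ) * (A * Nr)))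
      = Real.sqrt ((((K : ℝ))⁻¹ * h ^ 3 * T) ^ 2) * Real.sqrt (2 * ((K * M : ℕ) : ℝ) * (A * Nr)) := by
        rw [Real.sqrt_sq hw]; ring
    _ = Real.sqrt ((((K : ℝ))⁻¹ * h ^ 3 * T) ^ 2 * (2 * ((K * M : ℕ) : ℝ) * (A * Nr))) :=
        (Real.sqrt_mul (sq_nonneg _) _).symm
    _ ≤ Real.sqrt (ε ^ 2) := Real.sqrt_le_sqrt hsq
    _ = ε := Real.sqrt_sq hε.le

/-- **Registered helper `forecastSwap_holds` (piece H1 of S6): `ForecastSwap` holds** — the predictable-projection bound in the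
sequential start-cell filtration, summed over units with the weights `K⁻¹h³` and compared with the unit means through the tower
property; remainder `T √(54 A cellCount / K_N) ≤ ε` for large `N`. [folklore] -/
theorem forecastSwap_holds : ForecastSwap := by
  intro a₀ θ₀ u₀ ha hθ hu ha0 hθ0 σ hσ hhalf Φ τ hτ T hT c hc ε hε
  obtain ⟨A, hA, hLG⟩ := exists_lgTransferConst ha hθ hu ha0 hθ0 hhalf
  -- thresholds: mesh ≤ 1 and enough steps
  obtain ⟨N₁, hN₁⟩ := exists_mesh_le hσ c one_pos
  obtain ⟨N₂, hN₂⟩ := exists_lt_numSteps hσ hc hτ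
    (L := 54 * T ^ 2 * A * (c ^ 3 / (Real.pi ^ 3 * σ ^ 6)) / ε ^ 2) (by positivity)
  refine ⟨max N₁ N₂, fun N hN b hb X hXb hX0 hXa => ?_⟩
  have h1 : c * meanFreePath σ N ≤ 1 := hN₁ N ((le_max_left _ _).trans hN)
  have hK : 54 * T ^ 2 * A * (c ^ 3 / (Real.pi ^ 3 * σ ^ 6)) / ε ^ 2 < (numSteps c σ N τ : ℝ) :=
    hN₂ N ((le_max_right _ _).trans hN)
  have hh : 0 < c * meanFreePath σ N := mul_pos hc (meanFreePath_pos hσ N)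
  have hM : 0 < (cellBox (c * meanFreePath σ N)).card := card_cellBox_pos hh
  -- the two laws
  set μ := localGibbsLaw σ a₀ u₀ θ₀ N (Φ N) with hμ
  set ν := eqLaw σ N (Φ N) with hν
  haveI : IsProbabilityMeasure μ := isProbabilityMeasure_localGibbsLaw ha hθ hu ha0 hθ0 hhalf N (Φ N)
  haveI : IsProbabilityMeasure ν :=
    isProbabilityMeasure_localGibbsLaw (a₀ := fun _ => (1 : ℝ)) (θ₀ := fun _ => (1 : ℝ)) (u₀ := fun _ => (0 : V3))
      continuous_const continuous_const continuous_const (fun _ => one_pos) (fun _ => one_pos) hhalf N (Φ N)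
  obtain ⟨hkl, -, -, -, -⟩ := hLG N (Φ N)
  have hkl_ne : InformationTheory.klDiv μ ν ≠ ∞ := ne_top_of_le_ne_top ENNReal.ofReal_ne_top hkl
  have hac : μ ≪ ν := (InformationTheory.klDiv_ne_top_iff.1 hkl_ne).1
  have hklr : (InformationTheory.klDiv μ ν).toReal ≤ A * ((N : ℝ) + 1) :=
    ENNReal.toReal_le_of_le_ofReal (by positivity) hkl
  have hm : ∀ (k : ℕ) (q : Cell), (MeasurableSpace.comap (seqHist b c σ N (Φ N) k q) ⊤) ≤ (inferInstance : MeasurableSpace (Phase N)) :=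
    fun k q => comap_seqHist_le (Φ N) b c k q
  -- measurability, bounds, integrability
  have hXm : ∀ k q, Measurable (X k q) := by
    intro k q
    by_cases hq : q ∈ cellBox (c * meanFreePath σ N)
    · exact measurable_of_revealed (Φ N) b c k q (hXa k q hq)
    · rw [hX0 k q hq]
      exact measurable_const
  have hXabs : ∀ k q z, |X k q z| ≤ T := fun k q z => abs_le.2 ⟨by linarith [(hXb k q z).1], (hXb k q z).2⟩
  have hXi : ∀ k q, Integrable (X k q) μ := fun k q =>
    (integrable_const T).mono' (hXm k q).aestronglyMeasurable
      (ae_of_all _ fun z => by rw [Real.norm_eq_abs]; exact hXabs k q z)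
  have hGi : ∀ k q, Integrable (MeasureTheory.condExp (MeasurableSpace.comap (seqHist b c σ N (Φ N) k q) ⊤) ν (X k q)) μ := by
    intro k q
    have hbd : ∀ᵐ z ∂ν, |MeasureTheory.condExp (MeasurableSpace.comap (seqHist b c σ N (Φ N) k q) ⊤) ν (X k q) z| ≤ T :=
      ae_bdd_abs_condExp_of_ae_bdd_abs (ae_of_all _ fun z => hXabs k q z)
    have hbdμ : ∀ᵐ z ∂μ, |MeasureTheory.condExp (MeasurableSpace.comap (seqHist b c σ N (Φ N) k q) ⊤) ν (X k q) z| ≤ T :=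
      hac.ae_le hbd
    exact (integrable_const T).mono' (stronglyMeasurable_condExp.mono (hm k q)).aestronglyMeasurable
      (hbdμ.mono fun z hz => by rw [Real.norm_eq_abs]; exact hz)
  have hLi : ∀ k q, Integrable (MeasureTheory.condExp (MeasurableSpace.comap (seqHist b c σ N (Φ N) k q) ⊤) μ (X k q)) μ := fun k q => integrable_condExp
  -- box support, pointwise
  have hXbox : ∀ (z : Phase N) (k : ℕ), ∀ q ∉ cellBox (c * meanFreePath σ N), X k q z = 0 := fun z k q hq => by
    rw [hX0 k q hq]
  have hGbox : ∀ (z : Phase N) (k : ℕ), ∀ q ∉ cellBox (c * meanFreePath σ N), gForecast b c σ N (Φ N) X k q z = 0 := by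
    intro z k q hq
    show MeasureTheory.condExp (MeasurableSpace.comap (seqHist b c σ N (Φ N) k q) ⊤) ν (X k q) z = 0
    rw [hX0 k q hq, condExp_fun_zero]
  -- the two unit means as finite sums of integrals
  have hmeanX : unitMean c σ N τ μ X = ((numSteps c σ N τ : ℝ))⁻¹ * (c * meanFreePath σ N) ^ 3 *
      ∑ k ∈ Finset.range (numSteps c σ N τ), ∑ q ∈ cellBox (c * meanFreePath σ N), ∫ z, X k q z ∂μ := by
    unfold unitMean
    have hfun : (fun z => unitAvg c σ N τ fun k q => X k q z) = fun z => ((numSteps c σ N τ : ℝ))⁻¹ * (c * meanFreePath σ N) ^ 3 *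
        ∑ k ∈ Finset.range (numSteps c σ N τ), ∑ q ∈ cellBox (c * meanFreePath σ N), X k q z :=
      funext fun z => unitAvg_eq_sum c σ N τ _ (hXbox z)
    rw [hfun, integral_const_mul, integral_finsetSum _ fun k _ => integrable_finsetSum _ fun q _ => hXi k q]
    congr 1
    exact Finset.sum_congr rfl fun k _ => integral_finsetSum _ fun q _ => hXi k q
  have hmeanG : unitMean c σ N τ μ (gForecast b c σ N (Φ N) X) = ((numSteps c σ N τ : ℝ))⁻¹ * (c * meanFreePath σ N) ^ 3 *
      ∑ k ∈ Finset.range (numSteps c σ N τ), ∑ q ∈ cellBox (c * meanFreePath σ N), ∫ z, MeasureTheory.condExp (MeasurableSpace.comap (seqHist b c σ N (Φ N) k q) ⊤) ν (X k q) z ∂μ := by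
    unfold unitMean
    have hfun : (fun z => unitAvg c σ N τ fun k q => gForecast b c σ N (Φ N) X k q z) = fun z => ((numSteps c σ N τ : ℝ))⁻¹ * (c * meanFreePath σ N) ^ 3 *
        ∑ k ∈ Finset.range (numSteps c σ N τ), ∑ q ∈ cellBox (c * meanFreePath σ N), MeasureTheory.condExp (MeasurableSpace.comap (seqHist b c σ N (Φ N) k q) ⊤) ν (X k q) z :=
      funext fun z => unitAvg_eq_sum c σ N τ _ (hGbox z)
    rw [hfun, integral_const_mul, integral_finsetSum _ fun k _ => integrable_finsetSum _ fun q _ => hGi k q]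
    congr 1
    exact Finset.sum_congr rfl fun k _ => integral_finsetSum _ fun q _ => hGi k q
  -- the engine on the stage increments
  set Xs : ℕ → Phase N → ℝ := fun n z => X (n / (cellBox (c * meanFreePath σ N)).card) (nthCell (c * meanFreePath σ N) (n % (cellBox (c * meanFreePath σ N)).card)) z with hXs
  have hadapt : ∀ n, Measurable[pastSigma (Yseq b c σ N (Φ N)) (n + 1)] (Xs n) := by
    intro n
    have hj : n % (cellBox (c * meanFreePath σ N)).card < (cellBox (c * meanFreePath σ N)).card := Nat.mod_lt _ hM
    have hq : nthCell (c * meanFreePath σ N) (n % (cellBox (c * meanFreePath σ N)).card) ∈ cellBox (c * meanFreePath σ N) := nthCell_mem_cellBox hj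
    have hn : n + 1 = n / (cellBox (c * meanFreePath σ N)).card * (cellBox (c * meanFreePath σ N)).card + cellRank (c * meanFreePath σ N) (nthCell (c * meanFreePath σ N) (n % (cellBox (c * meanFreePath σ N)).card)) + 1 := by
      rw [cellRank_nthCell hj, Nat.div_add_mod']
    rw [hn]
    exact measurable_pastSigma_Yseq_succ_of_imp (Φ N) b c hσ hc (n / (cellBox (c * meanFreePath σ N)).card) hq (hXa _ _ hq)
  have hPP := predictableProjection_holds μ ν (Yseq b c σ N (Φ N)) Xs T (numSteps c σ N τ * (cellBox (c * meanFreePath σ N)).card)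
    (pastSigma_Yseq_le (Φ N) b c) hadapt (fun n z => hXabs _ _ z) hkl_ne
  -- reindex the engine's sum by units
  have hre : ∑ n ∈ Finset.range (numSteps c σ N τ * (cellBox (c * meanFreePath σ N)).card),
      ∫ z, |MeasureTheory.condExp (pastSigma (Yseq b c σ N (Φ N)) n) μ (Xs n) z -
        MeasureTheory.condExp (pastSigma (Yseq b c σ N (Φ N)) n) ν (Xs n) z| ∂μ =
      ∑ k ∈ Finset.range (numSteps c σ N τ), ∑ q ∈ cellBox (c * meanFreePath σ N),
        ∫ z, |MeasureTheory.condExp (MeasurableSpace.comap (seqHist b c σ N (Φ N) k q) ⊤) μ (X k q) z - MeasureTheory.condExp (MeasurableSpace.comap (seqHist b c σ N (Φ N) k q) ⊤) ν (X k q) z| ∂μ := by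
    rw [sum_range_mul_card_cellBox (c * meanFreePath σ N) (numSteps c σ N τ)]
    refine Finset.sum_congr rfl fun k _ => Finset.sum_congr rfl fun q hq => ?_
    have hXq : Xs (k * (cellBox (c * meanFreePath σ N)).card + cellRank (c * meanFreePath σ N) q) = X k q := by
      funext z
      simp only [hXs]
      rw [stage_div hq, nthCell_stage_mod hq]
    rw [hXq, pastSigma_Yseq_eq_seqHist (Φ N) b c hσ hc k q hq]
  rw [hre] at hPP
  -- the tower property and the triangle inequality
  have htower : ∀ k q, ∫ z, X k q z ∂μ = ∫ z, MeasureTheory.condExp (MeasurableSpace.comap (seqHist b c σ N (Φ N) k q) ⊤) μ (X k q) z ∂μ :=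
    fun k q => (integral_condExp (hm k q)).symm
  have hdiff : |unitMean c σ N τ μ X - unitMean c σ N τ μ (gForecast b c σ N (Φ N) X)| ≤
      ((numSteps c σ N τ : ℝ))⁻¹ * (c * meanFreePath σ N) ^ 3 * (T * Real.sqrt (2 * ((numSteps c σ N τ * (cellBox (c * meanFreePath σ N)).card : ℕ) : ℝ) * (A * ((N : ℝ) + 1)))) := by
    rw [hmeanX, hmeanG, ← mul_sub, abs_mul, abs_of_nonneg (by positivity : (0 : ℝ) ≤ ((numSteps c σ N τ : ℝ))⁻¹ * (c * meanFreePath σ N) ^ 3)]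
    refine mul_le_mul_of_nonneg_left ?_ (by positivity)
    rw [← Finset.sum_sub_distrib]
    refine (Finset.abs_sum_le_sum_abs _ _).trans ?_
    have hstep : ∀ k ∈ Finset.range (numSteps c σ N τ),
        |∑ q ∈ cellBox (c * meanFreePath σ N), ∫ z, X k q z ∂μ - ∑ q ∈ cellBox (c * meanFreePath σ N), ∫ z, MeasureTheory.condExp (MeasurableSpace.comap (seqHist b c σ N (Φ N) k q) ⊤) ν (X k q) z ∂μ| ≤
          ∑ q ∈ cellBox (c * meanFreePath σ N),
            ∫ z, |MeasureTheory.condExp (MeasurableSpace.comap (seqHist b c σ N (Φ N) k q) ⊤) μ (X k q) z - MeasureTheory.condExp (MeasurableSpace.comap (seqHist b c σ N (Φ N) k q) ⊤) ν (X k q) z| ∂μ := by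
      intro k _
      rw [← Finset.sum_sub_distrib]
      refine (Finset.abs_sum_le_sum_abs _ _).trans (Finset.sum_le_sum fun q _ => ?_)
      rw [htower k q, ← integral_sub (hLi k q) (hGi k q)]
      exact abs_integral_le_integral_abs
    refine (Finset.sum_le_sum hstep).trans (hPP.trans ?_)
    refine mul_le_mul_of_nonneg_left (Real.sqrt_le_sqrt ?_) hT.le
    exact mul_le_mul_of_nonneg_left hklr (by positivity)
  -- the remainder is small
  refine hdiff.trans (remainder_le ((N : ℝ) + 1) hh hT.le hA hε hK (card_cellBox_mul_le hh h1) ?_ (by positivity))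
  rw [← cellCount_eq c hσ N]
  unfold cellCount
  ring

end Summit.AtomisticToContinuum.HydrodynamicLimit.Theorems.EquilibriumForecastLine

end
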